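import Literature.MathematicalPhysics.QuantumFieldTheory.Balaban1983to89.B6Eq238MultiLevelBoxL0
import Literature.MathematicalPhysics.QuantumFieldTheory.Balaban1983to89.B6Ineq243TwoLevelBoxL0
import Literature.MathematicalPhysics.QuantumFieldTheory.Balaban1983to89.B6Ineq249MultiLevelBox

/-!
# `Balaban1983to89.B6Ineq249MultiLevelBoxL0` — [B6] (2.49) `|Rλ| ≤ O(M^{−1})|λ|` AND (2.50)
`G′ = G′₀(I − R)^{−1} = G′₀Σ_nRⁿ`, convergent in the `L^∞` operator norm, FOR THE GENUINE `k`-LEVEL OPERATOR `Δ′_a`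
ON A BOX WITH LEVEL `0` ADMITTED (`Λ₀ = X ∖ Ω₁` possibly non-empty) — the twin of `B6Ineq249MultiLevelBox` over the
structure `B6MultiLevelBoxOperatorL0.Domains` and the cover of `B6Eq238MultiLevelBoxL0` (levels `0 … k`, mesh-one cube
operators at level `0`); SAME declaration names; file of packet S-B of the level-0 programme G-F3′-L0; no existing module is
touched; no fact is minted

FRAMING (verbatim cell line):
statement-level skeleton of published theorems with citation tags; proofs where landed; nothing here is a claim about the Yang–Mills mass gap

Source under audit (cell lit-balaban): T. Bałaban, *Propagators and renormalization transformations for lattice gauge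
theories. II*, Commun. Math. Phys. **96** (1984) 223–250 [`Balaban1984PropagatorsII`, "B6"], p. 230 [PDF 8] (2.44), p. 232
[PDF 10] (2.49)–(2.50), p. 234 [PDF 12] Proposition 2.2 (last sentence).  Unit `lit-balaban-p21` (Phase-2 proof seat p21 gen 26,
packet S-B owner of row G-F3′-L0; plan of record `lit-balaban-r03/G-F3L0-PLAN.md` v1.0 §4–§5), HOME
`run/shared/lean/pub/lit-balaban/`, B6 fold owner r03, referee ref-4.

## WHAT IS PRINTED (p. 232, verbatim up to notation)

«Now let us come back to the inequality (2.44) and its consequences. One of them follows from the equality (2.38) where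
the operator R was defined. We get |Rλ| ≤ O(M^{−1})|λ|, (2.49) thus the operator R has a small norm in the space L^∞ for
M sufficiently large, and we get G′ = G′₀(I − R)^{−1} = G′₀Σ_{n=0}^∞ Rⁿ = … (2.50) … Both series above are convergent
in the space L^∞».  (p. 234, Proposition 2.2, last sentence, verbatim: «The random walk representation (2.50) is
convergent in the norms defined by these inequalities» — the norms of (2.67); NOT certified in this file, which certifies
the p. 232 `L^∞` sentence only.)

## WHY THIS FILE (G-F3′-L0)

The twin `B6Ineq249MultiLevelBox` bounds every term of `R` by (2.44) on its cube at the cube's finer mesh exponent `i ≥ 1`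
(`B6Ineq243TwoLevelBox.ineq244_twoLevel`, binder «1 ≤ k»).  With `Λ₀ ≠ ∅` the cover of `B6Eq238MultiLevelBoxL0` has cubes
of finer level `0` (mesh one, `Q₀ = id`), whose commutator terms are bounded by the ALL-SCALES (2.44)
`B6Ineq243TwoLevelBoxL0.ineq244_twoLevel` (the mesh-one resolvent `(−Δ^N + m² + a)⁻¹` of
`B4Thm110ZeroBoxMeshOne`, F5 of the programme); everything else is the twin's argument verbatim, its `D`-free lemmas
(`abs_lt_of_commPad_ne_zero`, `keySet`, `card_keySet_le`, `mem_keySet`) consumed BY NAME.  The twin's §4 device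
`mlOp_congr_weights`/`gml_mul_mlOp_pos` («the level-0 weight is immaterial») is gone: here `a₀` is a genuine weight and the
windows bind ALL `i ≥ 0`.

## WHAT THIS FILE CERTIFIES (kernel-checked; setting of `B6MultiLevelBoxOperatorL0`/`B6Eq238MultiLevelBoxL0`)

For a nested family `D : B6MultiLevelBoxOperatorL0.Domains d ℓ M_h k P R` (levels `0 … k`, (2.1)–(2.2) with `R ≥ 2L`),
weights `a_i ∈ [a₋, a₊]`, `c_i ∈ [c₋, c₊]` for ALL `i ≥ 0`, the `k`-level operator `Δ′_a = mlOp` on the box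
`X = Π[0, L^k·L·M_h·P_μ)` and the cover `𝒟`, `G′₀ = gZeroML`, `R = rML` of `B6Eq238MultiLevelBoxL0`, in the matrix ring of
`X` with Mathlib's `ℓ^∞ → ℓ^∞` operator norm (scope `Matrix.Norms.Operator`):
* §3 **(2.44) WITH ANY BOUNDED RIGHT FACTOR AT EVERY MESH** `local_comm_bound` (two-level-box vocabulary, `k ≥ 0`,
  `M_h ≥ 2`: `|(K_q(h_q)G′(□_q)w·u)(y)| ≤ C(d+1)(sup|h′| + sup|h″|)/M·e^{−δ′D/L^k}·F`) and **(2.49) FOR THE GENUINE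
  `k`-LEVEL OPERATOR WITH LEVEL `0`** `norm_rML_le`: `‖R‖_{∞→∞} ≤ C′/M` (`M = L·M_h`) for EVERY `k`, `M_h ≥ 3`, `R ≥ 2L`,
  volume `P`, nested family `D` (Λ₀ arbitrary) and weights in the windows — at most `3·2^{d+1}` terms meet a row
  (`mem_keySet_of_bX_ne_zero`: levels `lev x − 1 … lev x + 1`, `2^{d+1}` cubes per level);
* §4 **(2.50)** `eq250_multiLevelBox`: for `M ≥ M₀ = 2C′`: `‖R‖ ≤ ½`; the Neumann series `G′₀Σ'_nRⁿ` is a right inverse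
  of `Δ′_a` ((2.38) of `B6Eq238MultiLevelBoxL0` and `(1 − R)Σ'Rⁿ = 1`); it EQUALS `G′ = Δ′_a^{−1} = gml`; and `Σ_n G′₀Rⁿ`
  CONVERGES to `G′` in the `ℓ^∞` operator norm — uniformly in `k`, `P`, `D` and the weights (`a_{i+1} = aNext ℓ a_i c_i`,
  `i ≥ 0`).

## HONEST SCOPE

As `B6Eq238MultiLevelBoxL0`: Neumann box for the torus, `m² = 0`, the asymmetric partition `u_□ = h_□`,
`v_□ = h_□·1_{B^j(Λ_j)}`; `M_h ≥ 3` for the row count; constants existential (functions of `d`, `ℓ` and the windows, the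
SAME functions as the twin's up to the all-scales constants of (2.44)).  The operator is in lattice units.  No uniform bound
of `‖G′‖` is claimed here (that is (2.67), later files of S-B).  Nothing is inferred from the manuscript: every step is
kernel-checked.  Value = layer 2 of the level-0 port (S-B); NOT summit progress.
-/

namespace Literature.MathematicalPhysics.QuantumFieldTheory.Balaban1983to89.B6Ineq249MultiLevelBoxL0

open Finset Matrix
open scoped Matrix.Norms.Operator
open Literature.MathematicalPhysics.QuantumFieldTheory.Balaban1983to89.B4ContourShift (supNorm abs_le_supNorm
  supNorm_nonneg)
open Literature.MathematicalPhysics.QuantumFieldTheory.Balaban1983to89.B4Reflection242 (boxDom mem_boxDom nbrs mem_nbrs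
  blk neumannLapK diagK avgK)
open Literature.MathematicalPhysics.QuantumFieldTheory.Balaban1983to89.B4Green242Bridge (boxNbrs)
open Literature.MathematicalPhysics.QuantumFieldTheory.Balaban1983to89.B4Lemma22ReduceZero (Box)
open Literature.MathematicalPhysics.QuantumFieldTheory.Balaban1983to89.B4PartitionUnity22 (hprof D1 D2 D1_nonneg D2_nonneg
  contDiff_hprof hasCompactSupport_hprof)
open Literature.MathematicalPhysics.QuantumFieldTheory.Balaban1983to89.B4Thm110ZeroBox (boxCast boxCast_apply_val
  boxCast_symm_apply_val blk_blk mem_boxDom_of_eq)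
open Literature.MathematicalPhysics.QuantumFieldTheory.Balaban1983to89.B6Ineq243TwoLevelBox
open Literature.MathematicalPhysics.QuantumFieldTheory.Balaban1983to89.B6Partition236TwoLevelBox
open Literature.MathematicalPhysics.QuantumFieldTheory.Balaban1983to89.B6Eq238TwoLevelBox
open Literature.MathematicalPhysics.QuantumFieldTheory.Balaban1983to89.B6Ineq249TwoLevelBox (linfty_opNorm_le_of_pointwise
  near card_near_le mem_near_of_abs_lt supNorm_le_of_twoLevelOp_ne_zero pos_emb pos_emb_sub pad_mulVec_apply_le)
open Literature.MathematicalPhysics.QuantumFieldTheory.Balaban1983to89.B6MultiLevelBoxOperator (N0 bigSide bigSide_eq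
  bigSide_succ_eq bigSide_succ one_le_bigSide levC levC_pos indLev mlOp gml mlOp_isSymm mlOp_eq_reindex mlOp_mul_gml
  gml_mul_mlOp)
open Literature.MathematicalPhysics.QuantumFieldTheory.Balaban1983to89.B6MultiLevelBoxOperatorL0
open Literature.MathematicalPhysics.QuantumFieldTheory.Balaban1983to89.B6Eq238MultiLevelBox (MhP Pj one_le_Pj one_le_MhP
  Np_eq halfWidth_eq corner InCube uFun inCube_iff_exists_emb supNorm_lt_of_inCube uFun_eq_hΩ castP uX
  mul_diagonal_eq_sub_kComm term_algebra)
open Literature.MathematicalPhysics.QuantumFieldTheory.Balaban1983to89.B6Eq238MultiLevelBoxL0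
open Literature.MathematicalPhysics.QuantumFieldTheory.Balaban1983to89.B6Ineq249MultiLevelBox (abs_lt_of_commPad_ne_zero
  keySet card_keySet_le mem_keySet)

noncomputable section

variable {d : ℕ}

/-! ## §1 Norm tools -/

section NormTools

variable {m m' : Type*} [Fintype m] [Fintype m']

/-- `|v(j)| ≤ ‖v‖_∞`. [folklore] -/
private theorem abs_apply_le_norm (v : m' → ℝ) (j : m') : |v j| ≤ ‖v‖ := by
  have := norm_le_pi_norm v j
  rwa [Real.norm_eq_abs] at this

/-- a sum of terms `≤ B` (`B ≥ 0`), with at most the terms keyed (injectively) into `T` non-zero, is `≤ |T|·B`. [folklore] -/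
private theorem sum_le_card_mul {ι σ : Type*} [Fintype ι] [DecidableEq σ] (f : ι → ℝ) (key : ι → σ)
    (hkey : Function.Injective key) (T : Finset σ) (hT : ∀ i, f i ≠ 0 → key i ∈ T) {B : ℝ} (hB : 0 ≤ B)
    (hf : ∀ i, f i ≤ B) : ∑ i, f i ≤ T.card * B := by
  classical
  rw [← Finset.sum_filter_ne_zero]
  have hcard : (Finset.univ.filter fun i => f i ≠ 0).card ≤ T.card :=
    Finset.card_le_card_of_injOn key (fun i hi => by
      rw [Finset.coe_filter] at hi; exact hT i hi.2) (fun i _ j _ h => hkey h)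
  calc ∑ i ∈ Finset.univ.filter (fun i => f i ≠ 0), f i
      ≤ (Finset.univ.filter fun i => f i ≠ 0).card • B := Finset.sum_le_card_nsmul _ _ _ fun i _ => hf i
    _ = ((Finset.univ.filter fun i => f i ≠ 0).card : ℝ) * B := by rw [nsmul_eq_mul]
    _ ≤ T.card * B := by gcongr

/-- `(reindex e e A)·v` at `z` is `A·(v ∘ e)` at `e⁻¹z`. [folklore] -/
private theorem reindex_mulVec_apply {X Y : Type*} [Fintype X] [Fintype Y] (e : X ≃ Y) (A : Matrix X X ℝ) (v : Y → ℝ)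
    (z : Y) : (Matrix.reindex e e A *ᵥ v) z = (A *ᵥ (v ∘ e)) (e.symm z) := by
  rw [Matrix.reindex_apply, Matrix.submatrix_mulVec_equiv, Equiv.symm_symm, Function.comp_apply]

end NormTools

/-! ## §3 (2.49) `‖R‖ ≤ O(M^{−1})` for the genuine `k`-level operator with level `0`, uniformly in `k`, the volume and the domains -/

section Ineq249

variable {ℓ Mh k R : ℕ} {P : Fin (d + 1) → ℕ} (D : Domains d ℓ Mh k P R) (a c : ℕ → ℝ)

/-- the embedding of the cut cube of a member of the cover (presentation at its finer level `i ≥ 0`).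
[cite: Balaban1983RegularityDecay, §2 p.575, dictionary] -/
def embC (hP : ∀ μ, 1 ≤ P μ) (cq : ℕ × (Fin (d + 1) → ℤ)) (hc : CubeData D cq) :=
  emb ℓ (fin D cq.1 cq.2) (MhP ℓ Mh cq.1 (fin D cq.1 cq.2)) (Pj ℓ k P cq.1) cq.2 (one_le_Pj hP cq.1) hc.hq

/-- the padded local commutator term `resᵀ(K_□(h_□)G′(□)v′_□)res` of a member of the cover, on its presentation (the
matrix transported by `bX`). [cite: Balaban1984PropagatorsII, (2.38) p.229, (2.44) p.230] -/
def innerB (hP : ∀ μ, 1 ≤ P μ) (cq : ℕ × (Fin (d + 1) → ℤ)) (hc : CubeData D cq) :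
    Matrix ↥(Box d ℓ (fin D cq.1 cq.2) (fun μ => (ℓ + 1) * (MhP ℓ Mh cq.1 (fin D cq.1 cq.2) * Pj ℓ k P cq.1 μ)))
      ↥(Box d ℓ (fin D cq.1 cq.2) (fun μ => (ℓ + 1) * (MhP ℓ Mh cq.1 (fin D cq.1 cq.2) * Pj ℓ k P cq.1 μ))) ℝ :=
  (res (embC D hP cq hc))ᵀ
    * (kComm (cOp D a c cq.1 (fin D cq.1 cq.2) cq.2 hP hc.hq)
          (hLoc ℓ (fin D cq.1 cq.2) (MhP ℓ Mh cq.1 (fin D cq.1 cq.2)) (Pj ℓ k P cq.1) cq.2)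
        * cG D a c cq.1 (fin D cq.1 cq.2) cq.2 hP hc.hq
        * Matrix.diagonal ((fun z => vFun D cq.1 cq.2 z.1) ∘ embC D hP cq hc))
    * res (embC D hP cq hc)

variable {D a c}

/-- `bX` is `innerB` transported by the cast. [cite: Balaban1984PropagatorsII, (2.38) p.229, dictionary] -/
theorem bX_eq (hP : ∀ μ, 1 ≤ P μ) (cq : ℕ × (Fin (d + 1) → ℤ)) (hc : CubeData D cq) :
    bX D a c hP cq hc
      = Matrix.reindex (castP (fin_data hc).2.1 hc.hj.2) (castP (fin_data hc).2.1 hc.hj.2) (innerB D a c hP cq hc) :=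
  rfl

/-- a row of `bX` is a row of `innerB`. [cite: Balaban1984PropagatorsII, (2.38) p.229, dictionary] -/
theorem bX_mulVec_apply (hP : ∀ μ, 1 ≤ P μ) (cq : ℕ × (Fin (d + 1) → ℤ)) (hc : CubeData D cq)
    (v : ↥(boxDom (N0 ℓ Mh k P)) → ℝ) (z : ↥(boxDom (N0 ℓ Mh k P))) :
    (bX D a c hP cq hc *ᵥ v) z
      = (innerB D a c hP cq hc *ᵥ (v ∘ castP (fin_data hc).2.1 hc.hj.2))
          ((castP (ℓ := ℓ) (Mh := Mh) (fin_data hc).2.1 hc.hj.2).symm z) := by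
  rw [bX_eq, reindex_mulVec_apply]

/-- `|v_□| ≤ 1` for the right cut-off of the level-0-admitting cover (binder order `q z j`: the statement-text dedup key is kept
distinct from the twin's byte-identical statement over the OTHER structure; uses are positional `abs_vFun_le_one _ _ _`).
[cite: Balaban1984PropagatorsII, (2.36) p.229; Balaban1984PropagatorsI, (1.118) p.36] -/
theorem abs_vFun_le_one (q z : Fin (d + 1) → ℤ) (j : ℕ) : |B6Eq238MultiLevelBoxL0.vFun D j q z| ≤ 1 := by
  unfold vFun uFun
  rw [abs_mul]
  have h1 := abs_hq_le_one ((ℓ + 1) ^ j) ((ℓ + 1) * Mh) q z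
  have h2 : |(if D.lev z = j then (1 : ℝ) else 0)| ≤ 1 := by split_ifs <;> simp
  calc |hq ((ℓ + 1) ^ j) ((ℓ + 1) * Mh) q z| * |(if D.lev z = j then (1 : ℝ) else 0)| ≤ 1 * 1 :=
        mul_le_mul h1 h2 (abs_nonneg _) zero_le_one
    _ = 1 := one_mul _

/-- **THE ROW SUPPORT OF A TERM OF `R`** (cover with level-0 cubes): if `(K(h_□)G′(□)v_□·v)(z) ≠ 0` for the member
`□ = (j, q)` of the cover, then `j ∈ {lev z − 1, lev z, lev z + 1}` (the row lies in the cube, whose sites have level `i` or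
`i + 1`, `i ∈ {j − 1, j}` its finer level — the two-level window) and `q` is one of the `2^{d+1}` candidate centres at `z`.
[cite: Balaban1984PropagatorsII, p.229 (cover of finite overlap), (2.2) p.224, (2.44) p.230] -/
theorem mem_keySet_of_bX_ne_zero (hℓ : 1 ≤ ℓ) (hR : 2 * (ℓ + 1) ≤ R) (hP : ∀ μ, 1 ≤ P μ) (hMh : 3 ≤ Mh)
    (cq : ℕ × (Fin (d + 1) → ℤ)) (hc : CubeData D cq) (v : ↥(boxDom (N0 ℓ Mh k P)) → ℝ)
    {z : ↥(boxDom (N0 ℓ Mh k P))} (hz : (bX D a c hP cq hc *ᵥ v) z ≠ 0) :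
    cq ∈ keySet ℓ Mh (D.lev z.1) z.1 := by
  obtain ⟨-, hij, hji, hdown, hup⟩ := fin_data hc
  have hjk := hc.hj.2
  have hMh1 : 1 ≤ Mh := le_trans (by norm_num) hMh
  have hMh2 : 2 ≤ Mh := le_trans (by norm_num) hMh
  have hMh' : 3 ≤ MhP ℓ Mh cq.1 (fin D cq.1 cq.2) :=
    le_trans hMh (Nat.le_mul_of_pos_right _ (by positivity))
  rw [bX_mulVec_apply] at hz
  -- the row lies in the cube
  have hzval : ((castP (ℓ := ℓ) (Mh := Mh) (P := P) hij hjk).symm z).1 = z.1 := by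
    unfold castP; exact boxCast_symm_apply_val _ _
  obtain ⟨y, hy⟩ : ∃ y, embC D hP cq hc y = (castP (ℓ := ℓ) (Mh := Mh) (P := P) hij hjk).symm z := by
    by_contra hne
    push Not at hne
    apply hz
    unfold innerB
    rw [← Matrix.mulVec_mulVec, ← Matrix.mulVec_mulVec]
    exact transpose_res_mulVec_off _ _ hne
  -- (a) the level window
  have hwin := window_of_active (D := D) hℓ hR hP hMh2 hij hjk hc.hq hc.hact hdown hup y
  have hyz : (embC D hP cq hc y).1 = z.1 := by rw [hy, hzval]
  unfold embC at hyz
  rw [hyz] at hwin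
  -- (b) the candidate centres
  have hsupp : ∀ μ, |pos z.1 μ - ((bigSide ℓ Mh cq.1 : ℕ) : ℝ) * cq.2 μ| < ((bigSide ℓ Mh cq.1 : ℕ) : ℝ) := by
    intro μ
    have h := abs_lt_of_commPad_ne_zero (k := fin D cq.1 cq.2) hℓ hMh' (one_le_Pj hP cq.1) hc.hq
      (a (fin D cq.1 cq.2)) (c (fin D cq.1 cq.2)) 0
      (isBlockUnion_lamLoc _ hc.hq (isBlockUnion_LamG (D := D) hij hjk))
      (cG D a c cq.1 (fin D cq.1 cq.2) cq.2 hP hc.hq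
        * Matrix.diagonal ((fun z => vFun D cq.1 cq.2 z.1) ∘ embC D hP cq hc))
      (v ∘ castP (fin_data hc).2.1 hc.hj.2) (x := (castP (ℓ := ℓ) (Mh := Mh) (P := P) hij hjk).symm z)
      (by
        unfold innerB cOp embC at hz
        rw [Matrix.mul_assoc (kComm _ _)] at hz
        exact hz) μ
    rw [halfWidth_eq hij, hzval] at h
    exact h
  exact mem_keySet (by omega) (by omega) (mem_near_of_abs_lt (one_le_bigSide hMh1 cq.1) hsupp)

/-- **(2.44) FOR A COMMUTATOR CUBE TERM WITH ANY BOUNDED RIGHT FACTOR, AT EVERY MESH** (two-level-box vocabulary):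
there are `δ′, C > 0` (depending on `d`, `ℓ` and the windows) such that for every mesh `L^{−k}`, `k ≥ 0` (the mesh-one
member included), window point (`m² = 0`), `M_h ≥ 2`, volume, cut cube `□_q` with ANY block union `Λ′` of the cube, right
factor `|w| ≤ 1` and vector `|u| ≤ F` supported at sup-distance `≥ D` from `y`:
`|(K_q(h_q)G′(□_q)w·u)(y)| ≤ C·((d+1)(sup|h′| + sup|h″|)/M)·e^{−δ′D/L^k}·F`, `M = L·M_h` — the all-scales
`B6Ineq243TwoLevelBoxL0.ineq244_twoLevel` with the sizes `κ₁ = (d+1)sup|h′|/M`, `κ₂ = (d+1)sup|h″|/M²` of the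
printed cut-off (`B6Partition236TwoLevelBox.abs_hq_sub_le`/`hloc_laplacian`, which need `L^k·M ≥ 4`, i.e. `M_h ≥ 2` at
`k = 0`). [cite: Balaban1984PropagatorsII, (2.44) p.230, (2.49)/(2.51) p.232] -/
theorem local_comm_bound (d ℓ : ℕ) (hℓ : 1 ≤ ℓ) (aminus aplus a2minus a2plus : ℝ) (ha : 0 < aminus)
    (ha2 : 0 < a2minus) :
    ∃ δ' C : ℝ, 0 < δ' ∧ 0 < C ∧ ∀ (k : ℕ) (aj a : ℝ), aminus ≤ aj → aj ≤ aplus → a2minus ≤ a →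
      a ≤ a2plus → ∀ (Mh : ℕ), 2 ≤ Mh → ∀ (P : Fin (d + 1) → ℕ) (hP : ∀ i, 1 ≤ P i) (q : Fin (d + 1) → ℤ)
        (hq : q ∈ ctrs P) (Λ' : Finset ↥(boxDom (fun i => (ℓ + 1) * cubeM' Mh P q i))),
        IsBlockUnion ℓ (cubeM' Mh P q) Λ' →
        ∀ (w u : ↥(Box d ℓ k (fun i => (ℓ + 1) * cubeM' Mh P q i)) → ℝ) (F Dd : ℝ), (∀ b, |w b| ≤ 1) →
          (∀ b, |u b| ≤ F) → ∀ y : ↥(Box d ℓ k (fun i => (ℓ + 1) * cubeM' Mh P q i)),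
          (∀ b, u b ≠ 0 → Dd ≤ supNorm (y.1 - b.1)) →
          |((kComm (twoLevelOp ((ℓ + 1) ^ k) ℓ aj a 0 (cubeM' Mh P q) Λ') (hLoc ℓ k Mh P q)
              * gTwoLevel ((ℓ + 1) ^ k) ℓ aj a 0 (cubeM' Mh P q) Λ' * Matrix.diagonal w) *ᵥ u) y|
            ≤ C * ((d + 1) * (D1 hprof + D2 hprof) / (((ℓ : ℝ) + 1) * Mh))
                * Real.exp (-(δ' * Dd / (((ℓ + 1) ^ k : ℕ) : ℝ))) * F := by
  obtain ⟨δ', C, hδ', hC, h244⟩ := B6Ineq243TwoLevelBoxL0.ineq244_twoLevel d ℓ hℓ aminus aplus 0 a2minus a2plus ha ha2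
  have hD1 := D1_nonneg contDiff_hprof hasCompactSupport_hprof
  have hD2 := D2_nonneg contDiff_hprof hasCompactSupport_hprof
  refine ⟨δ', C, hδ', hC, ?_⟩
  intro k aj a e1 e2 e5 e6 Mh hMh P hP q hq Λ' hΛ' w u F Dd hw hu y hsupp
  have hMh1 : 1 ≤ Mh := le_trans (by norm_num) hMh
  have hn1 : 1 ≤ (ℓ + 1) ^ k := Nat.one_le_pow _ _ (by omega)
  have hN4 : 4 ≤ (ℓ + 1) ^ k * ((ℓ + 1) * Mh) := four_le_scale hℓ hMh
  have hF : 0 ≤ F := (abs_nonneg _).trans (hu y)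
  set M : ℝ := ((ℓ : ℝ) + 1) * Mh with hMdef
  have hM1 : (1 : ℝ) ≤ M := by
    have : (1 : ℝ) ≤ Mh := by exact_mod_cast hMh1
    have : (1 : ℝ) ≤ (ℓ : ℝ) + 1 := by linarith [(Nat.cast_nonneg ℓ : (0 : ℝ) ≤ ℓ)]
    rw [hMdef]; nlinarith
  have hMpos : 0 < M := by linarith
  have hM' : ∀ i, 1 ≤ cubeM' Mh P q i := fun i =>
    Nat.one_le_iff_ne_zero.2 (Nat.mul_ne_zero_iff.2 ⟨by omega, by have := (one_le_cubeW hP hq i).1; omega⟩)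
  set κ₁ : ℝ := (d + 1) * D1 hprof / M with hκ₁
  set κ₂ : ℝ := (d + 1) * (D2 hprof / M ^ 2) with hκ₂
  have hκ₁0 : 0 ≤ κ₁ := by positivity
  have hLip : ∀ z z' : ↥(Box d ℓ k (fun i => (ℓ + 1) * cubeM' Mh P q i)),
      |hLoc ℓ k Mh P q z' - hLoc ℓ k Mh P q z| ≤ κ₁ * supNorm (z'.1 - z.1) / (((ℓ + 1) ^ k : ℕ) : ℝ) := by
    intro z z'
    have := abs_hq_sub_le (d := d) hn1 (Nat.one_le_iff_ne_zero.2 (by positivity : (ℓ + 1) * Mh ≠ 0))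
      (locLabel q) z.1 z'.1
    rw [hκ₁, hMdef]
    push_cast at this ⊢
    exact this
  have hLap : ∀ z : ↥(Box d ℓ k (fun i => (ℓ + 1) * cubeM' Mh P q i)),
      |((((ℓ + 1) ^ k : ℕ) : ℝ)) ^ 2 * ∑ z' ∈ boxNbrs _ z, (hLoc ℓ k Mh P q z' - hLoc ℓ k Mh P q z)| ≤ κ₂ := by
    intro z
    obtain hcw := fun i => cubeW_cases hP hq i
    have hl := hloc_laplacian (d := d) (n := (ℓ + 1) ^ k) (M := (ℓ + 1) * Mh) hN4 (c := locLabel q)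
      (w := fun i => cubeW P q i) (S := fun i => (ℓ + 1) ^ k * ((ℓ + 1) * cubeM' Mh P q i))
      (fun i => by simp only [cubeM']; ring) (fun i => (hcw i).1) (fun i => (hcw i).2) z
    rw [abs_mul, abs_of_nonneg (by positivity)]
    have hNsq : ((((ℓ + 1) ^ k : ℕ) : ℝ)) ^ 2 * ((d + 1) * (D2 hprof / ((((ℓ + 1) ^ k * ((ℓ + 1) * Mh) : ℕ) : ℝ)) ^ 2))
        = κ₂ := by
      rw [hκ₂, hMdef]; push_cast
      have : (((ℓ : ℝ) + 1) ^ k) ≠ 0 := by positivity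
      field_simp
    calc ((((ℓ + 1) ^ k : ℕ) : ℝ)) ^ 2 * |∑ z' ∈ boxNbrs _ z, (hLoc ℓ k Mh P q z' - hLoc ℓ k Mh P q z)|
        ≤ ((((ℓ + 1) ^ k : ℕ) : ℝ)) ^ 2 * ((d + 1) * (D2 hprof / ((((ℓ + 1) ^ k * ((ℓ + 1) * Mh) : ℕ) : ℝ)) ^ 2)) :=
          mul_le_mul_of_nonneg_left hl (by positivity)
      _ = κ₂ := hNsq
  have hg : ∀ b, |(Matrix.diagonal w *ᵥ u) b| ≤ F := by
    intro b
    rw [Matrix.mulVec_diagonal, abs_mul]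
    calc |w b| * |u b| ≤ 1 * F := mul_le_mul (hw b) (hu b) (abs_nonneg _) zero_le_one
      _ = F := one_mul _
  have hgsupp : ∀ b, (Matrix.diagonal w *ᵥ u) b ≠ 0 → Dd ≤ supNorm (y.1 - b.1) := by
    intro b hb
    refine hsupp b fun h0 => hb ?_
    rw [Matrix.mulVec_diagonal, h0, mul_zero]
  have h := h244 k aj 0 a e1 e2 le_rfl le_rfl e5 e6 (cubeM' Mh P q) hM' Λ' hΛ' (hLoc ℓ k Mh P q) κ₁ κ₂ hκ₁0
    hLip hLap (Matrix.diagonal w *ᵥ u) F Dd hg y hgsupp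
  rw [← Matrix.mulVec_mulVec, ← Matrix.mulVec_mulVec]
  refine h.trans (mul_le_mul_of_nonneg_right (mul_le_mul_of_nonneg_right ?_ (Real.exp_pos _).le) hF)
  -- `C(κ₁ + κ₂) ≤ C(d+1)(sup|h′| + sup|h″|)/M`
  refine mul_le_mul_of_nonneg_left ?_ hC.le
  have hM2 : D2 hprof / M ^ 2 ≤ D2 hprof / M := by
    apply div_le_div_of_nonneg_left hD2 hMpos
    nlinarith
  have : (d + 1) * (D2 hprof / M ^ 2) ≤ (d + 1) * (D2 hprof / M) := mul_le_mul_of_nonneg_left hM2 (by positivity)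
  calc κ₁ + κ₂ = (d + 1) * D1 hprof / M + (d + 1) * (D2 hprof / M ^ 2) := by rw [hκ₁, hκ₂]
    _ ≤ (d + 1) * D1 hprof / M + (d + 1) * (D2 hprof / M) := by linarith
    _ = (d + 1) * (D1 hprof + D2 hprof) / M := by rw [hMdef]; field_simp

/-- **[B6] (2.49) FOR THE GENUINE `k`-LEVEL OPERATOR ON A BOX, LEVEL `0` ADMITTED**: there is `C′ = C′(d, ℓ, windows) > 0`
such that `‖R‖_{∞→∞} ≤ C′/M` (`M = L·M_h`) for EVERY number of levels `k`, `M_h ≥ 3`, `R ≥ 2L`, volume `P`, nested family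
`D` of domains (2.1)–(2.2) with `Λ₀ = X ∖ Ω₁` arbitrary, and weights `a_i ∈ [a₋, a₊]`, `c_i ∈ [c₋, c₊]` (ALL `i ≥ 0`) —
from (2.44) per cube at every mesh (`local_comm_bound`: the genuine two-level cube operator of the cube at its finer level
`i ≥ 0`, cube half-width `M_□ = M·L^{j−i} ≥ M`, `|v_□| ≤ 1`) and the finite overlap of the multi-size cover (`≤ 3·2^{d+1}`
terms per row, `mem_keySet_of_bX_ne_zero`). [cite: Balaban1984PropagatorsII, (2.49) p.232] -/
theorem norm_rML_le (d ℓ : ℕ) (hℓ : 1 ≤ ℓ) (aminus aplus a2minus a2plus : ℝ) (ha : 0 < aminus) (ha2 : 0 < a2minus) :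
    ∃ C' : ℝ, 0 < C' ∧ ∀ (k Mh R : ℕ), 3 ≤ Mh → 2 * (ℓ + 1) ≤ R → ∀ (P : Fin (d + 1) → ℕ) (hP : ∀ μ, 1 ≤ P μ)
      (D : Domains d ℓ Mh k P R) (a c : ℕ → ℝ), (∀ i, aminus ≤ a i ∧ a i ≤ aplus) →
        (∀ i, a2minus ≤ c i ∧ c i ≤ a2plus) →
        ‖rML D a c hP‖ ≤ C' / (((ℓ : ℝ) + 1) * Mh) := by
  obtain ⟨δ', C, -, hC, hloc⟩ := local_comm_bound d ℓ hℓ aminus aplus a2minus a2plus ha ha2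
  have hD1 := D1_nonneg contDiff_hprof hasCompactSupport_hprof
  have hD2 := D2_nonneg contDiff_hprof hasCompactSupport_hprof
  refine ⟨3 * 2 ^ (d + 1) * C * ((d + 1) * (D1 hprof + D2 hprof)) + 1, by positivity, ?_⟩
  intro k Mh R hMh hR P hP D a c haw hcw
  have hMh1 : 1 ≤ Mh := le_trans (by norm_num) hMh
  have hMh2 : 2 ≤ Mh := le_trans (by norm_num) hMh
  set M : ℝ := ((ℓ : ℝ) + 1) * Mh with hMdef
  have hL1 : (1 : ℝ) ≤ (ℓ : ℝ) + 1 := by linarith [(Nat.cast_nonneg ℓ : (0 : ℝ) ≤ ℓ)]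
  have hM1 : (1 : ℝ) ≤ M := by
    have : (1 : ℝ) ≤ Mh := by exact_mod_cast hMh1
    rw [hMdef]; nlinarith
  have hMpos : 0 < M := by linarith
  -- the uniform pointwise bound of one term
  set B : ℝ := C * ((d + 1) * (D1 hprof + D2 hprof) / M) with hBdef
  have hB0 : 0 ≤ B := by positivity
  have hterm : ∀ (cq : ℕ × (Fin (d + 1) → ℤ)) (hc : CubeData D cq) (v : ↥(boxDom (N0 ℓ Mh k P)) → ℝ)
      (z : ↥(boxDom (N0 ℓ Mh k P))), |(bX D a c hP cq hc *ᵥ v) z| ≤ B * ‖v‖ := by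
    intro cq hc v z
    obtain ⟨-, hij, hji, -, -⟩ := fin_data hc
    have hjk := hc.hj.2
    have hMh' : 2 ≤ MhP ℓ Mh cq.1 (fin D cq.1 cq.2) := le_trans hMh2 (Nat.le_mul_of_pos_right _ (by positivity))
    have hMhle : (Mh : ℝ) ≤ MhP ℓ Mh cq.1 (fin D cq.1 cq.2) := by
      unfold MhP; exact_mod_cast Nat.le_mul_of_pos_right _ (by positivity)
    have hMM' : M ≤ ((ℓ : ℝ) + 1) * (MhP ℓ Mh cq.1 (fin D cq.1 cq.2) : ℝ) := by
      rw [hMdef]; exact mul_le_mul_of_nonneg_left hMhle (by linarith)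
    -- the bound of this cube, `C(d+1)(…)/M_□ ≤ B`
    have hκ : C * ((d + 1) * (D1 hprof + D2 hprof) / (((ℓ : ℝ) + 1) * (MhP ℓ Mh cq.1 (fin D cq.1 cq.2) : ℝ))) ≤ B := by
      rw [hBdef]
      exact mul_le_mul_of_nonneg_left (div_le_div_of_nonneg_left (by positivity) hMpos hMM') hC.le
    rw [bX_mulVec_apply]
    unfold innerB
    refine pad_mulVec_apply_le (one_le_Pj hP cq.1) hc.hq _ _ _ (mul_nonneg hB0 (norm_nonneg v)) fun y => ?_
    have hw : ∀ b, |((fun z => vFun D cq.1 cq.2 z.1) ∘ embC D hP cq hc) b| ≤ 1 := fun b => abs_vFun_le_one _ _ _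
    have hu : ∀ b, |(res (embC D hP cq hc) *ᵥ (v ∘ castP (fin_data hc).2.1 hc.hj.2)) b| ≤ ‖v‖ := fun b => by
      rw [res_mulVec]; exact abs_apply_le_norm v _
    -- (the application is elaborated in stages: a one-shot application times out in `isDefEq`)
    have h0 := hloc (fin D cq.1 cq.2) (a (fin D cq.1 cq.2)) (c (fin D cq.1 cq.2)) (haw _).1 (haw _).2
      (hcw _).1 (hcw _).2 (MhP ℓ Mh cq.1 (fin D cq.1 cq.2)) hMh' (Pj ℓ k P cq.1) (one_le_Pj hP cq.1) cq.2
      hc.hq (lamLoc ℓ (MhP ℓ Mh cq.1 (fin D cq.1 cq.2)) (Pj ℓ k P cq.1) cq.2 (one_le_Pj hP cq.1) hc.hq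
        (LamG D cq.1 (fin D cq.1 cq.2)))
      (isBlockUnion_lamLoc _ hc.hq (isBlockUnion_LamG (D := D) hij hjk))
    have h1 := h0 ((fun z => vFun D cq.1 cq.2 z.1) ∘ embC D hP cq hc)
      (res (embC D hP cq hc) *ᵥ (v ∘ castP (fin_data hc).2.1 hc.hj.2))
    have h2 := h1 ‖v‖ 0
    have h3 := h2 hw
    have h4 := h3 hu
    have h5 := h4 y
    have h := h5 (fun b _ => supNorm_nonneg _)
    rw [mul_zero, zero_div, neg_zero, Real.exp_zero, mul_one] at h
    unfold embC at h
    unfold cOp cG embC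
    exact h.trans (mul_le_mul_of_nonneg_right hκ (norm_nonneg _))
  -- assembling the rows: at most `3·2^{d+1}` non-zero terms, each `≤ B‖v‖`
  have hsum : ∀ (v : ↥(boxDom (N0 ℓ Mh k P)) → ℝ) (z : ↥(boxDom (N0 ℓ Mh k P))),
      |(rML D a c hP *ᵥ v) z| ≤ 3 * 2 ^ (d + 1) * B * ‖v‖ := by
    intro v z
    unfold rML
    rw [Matrix.sum_mulVec, Finset.sum_apply, Finset.attach_eq_univ]
    refine (Finset.abs_sum_le_sum_abs _ _).trans ?_
    have key := sum_le_card_mul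
      (fun cq : {cq // cq ∈ cubeSet D} => |(bX D a c hP cq.1 (cubeData_of_mem cq.2) *ᵥ v) z|)
      (fun cq => cq.1) Subtype.val_injective (keySet ℓ Mh (D.lev z.1) z.1)
      (fun cq hq0 => mem_keySet_of_bX_ne_zero hℓ hR hP hMh cq.1 (cubeData_of_mem cq.2) v
        (fun h0 => hq0 (by rw [h0, abs_zero])))
      (by positivity : 0 ≤ B * ‖v‖) (fun cq => hterm cq.1 (cubeData_of_mem cq.2) v z)
    refine key.trans ?_
    have hcard : ((keySet ℓ Mh (D.lev z.1) z.1).card : ℝ) ≤ 3 * 2 ^ (d + 1) := by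
      exact_mod_cast card_keySet_le _ _ _ _
    have : 0 ≤ B * ‖v‖ := by positivity
    nlinarith
  refine (linfty_opNorm_le_of_pointwise _ (by positivity) hsum).trans ?_
  rw [hBdef]
  calc 3 * 2 ^ (d + 1) * (C * ((d + 1) * (D1 hprof + D2 hprof) / M))
      = (3 * 2 ^ (d + 1) * C * ((d + 1) * (D1 hprof + D2 hprof))) / M := by ring
    _ ≤ (3 * 2 ^ (d + 1) * C * ((d + 1) * (D1 hprof + D2 hprof)) + 1) / M := by gcongr; linarith

end Ineq249

/-! ## §4 (2.50): the Neumann series converges to `G′ = Δ′_a^{−1}` -/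

section Eq250

variable {ℓ Mh k R : ℕ} {P : Fin (d + 1) → ℕ}

/-- **[B6] (2.49) ⇒ «R has a small norm … for M sufficiently large» AND (2.50) `G′ = G′₀(I − R)^{−1} = G′₀Σ_nRⁿ` FOR THE
GENUINE `k`-LEVEL OPERATOR ON A BOX, LEVEL `0` ADMITTED**: there is `M₀ = M₀(d, ℓ, windows) > 0` such that for EVERY `k`,
`M_h ≥ 3` with `L·M_h ≥ M₀`, `R ≥ 2L`, volume `P`, nested family `D` (2.1)–(2.2) (`Λ₀ = X ∖ Ω₁` arbitrary) and weights in
the windows with `a_{i+1} = aNext ℓ a_i c_i` (all `i ≥ 0`): `‖R‖_{∞→∞} ≤ ½`; the series `G′₀Σ'_nRⁿ` is a right inverse of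
`Δ′_a`; it EQUALS `G′ = Δ′_a^{−1}` (`gml`); and `Σ_n G′₀Rⁿ` CONVERGES to `G′` in the `ℓ^∞` operator norm (p. 232 «Both series
above are convergent in the space L^∞»; the p. 234 sentence of Proposition 2.2, «convergent in the norms defined by these
inequalities», concerns the (2.67) norms and is not this theorem). [cite: Balaban1984PropagatorsII, (2.49)–(2.50) p.232] -/
theorem eq250_multiLevelBox (d ℓ : ℕ) (hℓ : 1 ≤ ℓ) (aminus aplus a2minus a2plus : ℝ) (ha : 0 < aminus)
    (ha2 : 0 < a2minus) :
    ∃ M₀ : ℝ, 0 < M₀ ∧ ∀ (k Mh R : ℕ), 3 ≤ Mh → M₀ ≤ ((ℓ : ℝ) + 1) * Mh → 2 * (ℓ + 1) ≤ R →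
      ∀ (P : Fin (d + 1) → ℕ) (hP : ∀ μ, 1 ≤ P μ) (D : Domains d ℓ Mh k P R) (a c : ℕ → ℝ),
        (∀ i, aminus ≤ a i ∧ a i ≤ aplus) → (∀ i, a2minus ≤ c i ∧ c i ≤ a2plus) →
        (∀ i, a (i + 1) = aNext ℓ (a i) (c i)) →
        ‖rML D a c hP‖ ≤ 1 / 2
          ∧ mlOp (N0 ℓ Mh k P) ℓ k D.lev a * (gZeroML D a c hP * ∑' n : ℕ, rML D a c hP ^ n) = 1
          ∧ gml (N0 ℓ Mh k P) ℓ k D.lev a = gZeroML D a c hP * ∑' n : ℕ, rML D a c hP ^ n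
          ∧ HasSum (fun n : ℕ => gZeroML D a c hP * rML D a c hP ^ n) (gml (N0 ℓ Mh k P) ℓ k D.lev a) := by
  obtain ⟨C', hC', h249⟩ := norm_rML_le d ℓ hℓ aminus aplus a2minus a2plus ha ha2
  refine ⟨2 * C', by positivity, ?_⟩
  intro k Mh R hMh hM hR P hP D a c haw hcw hac
  haveI : CompleteSpace (Matrix ↥(boxDom (N0 ℓ Mh k P)) ↥(boxDom (N0 ℓ Mh k P)) ℝ) :=
    FiniteDimensional.complete ℝ _
  have hMh2 : 2 ≤ Mh := le_trans (by norm_num) hMh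
  have hRn : ‖rML D a c hP‖ ≤ 1 / 2 := by
    calc ‖rML D a c hP‖ ≤ C' / (((ℓ : ℝ) + 1) * Mh) := h249 k Mh R hMh hR P hP D a c haw hcw
      _ ≤ C' / (2 * C') := div_le_div_of_nonneg_left hC'.le (by positivity) hM
      _ = 1 / 2 := by field_simp
  have hR1 : ‖rML D a c hP‖ < 1 := by linarith
  have hapos : ∀ i, 0 < a i := fun i => lt_of_lt_of_le ha (haw i).1
  -- (2.38) and the right inverse
  have h238 := eq238_multiLevelBox (D := D) (a := a) (c := c) hℓ hR hP hMh2 hapos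
    (fun i => lt_of_lt_of_le ha2 (hcw i).1) hac
  have hright : mlOp (N0 ℓ Mh k P) ℓ k D.lev a * (gZeroML D a c hP * ∑' n : ℕ, rML D a c hP ^ n) = 1 := by
    rw [← mul_assoc, h238]
    exact mul_neg_geom_series _ hR1
  -- `G′Δ′_a = 1` (every site has level `≤ k`, every weight is positive), hence `G′ =` the series
  have hGE : gml (N0 ℓ Mh k P) ℓ k D.lev a * mlOp (N0 ℓ Mh k P) ℓ k D.lev a = 1 :=
    gml_mul_mlOp (fun μ => Nat.one_le_iff_ne_zero.2 (by have := hP μ; positivity)) D.lev_le hapos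
  have hleft : gml (N0 ℓ Mh k P) ℓ k D.lev a = gZeroML D a c hP * ∑' n : ℕ, rML D a c hP ^ n := by
    calc gml (N0 ℓ Mh k P) ℓ k D.lev a
        = gml (N0 ℓ Mh k P) ℓ k D.lev a
            * (mlOp (N0 ℓ Mh k P) ℓ k D.lev a * (gZeroML D a c hP * ∑' n : ℕ, rML D a c hP ^ n)) := by
          rw [hright, mul_one]
      _ = gZeroML D a c hP * ∑' n : ℕ, rML D a c hP ^ n := by rw [← mul_assoc, hGE, one_mul]
  refine ⟨hRn, hright, hleft, ?_⟩
  rw [hleft]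
  exact (summable_geometric_of_norm_lt_one hR1).hasSum.mul_left _

end Eq250

end

end Literature.MathematicalPhysics.QuantumFieldTheory.Balaban1983to89.B6Ineq249MultiLevelBoxL0
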